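import Mathlib
import HarnessLib
import Summits.Ventures.LatticeQCDFlow.Scoring.SplitChain

/-!
# Regeneration as an identity of laws on path space: weighted by any nonnegative functional of the
# past and restricted to "the next coin is heads", the FUTURE PATH of the split chain is the split
# chain started afresh from `ν ⊗ δ_true` — and its state path is the `κ`-chain from `ν`

HONEST FRAMING: exact (Metropolis-corrected) sampling algorithms for lattice gauge theory;
figures of merit are autocorrelation/cost numbers at stated couplings and volumes; no
continuum-physics claim.

Venture `LatticeQCDFlow` (cell pub-lqcd), topic `Scoring`; FANOUT row 8 (`s0-cpn-nemc`, GEN-15).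
NEW WORK of the cell, not a published result; no definition is introduced.
`Scoring/SplitChain.lean` realised the Nummelin split chain of a Doeblin kernel `κ(x, ·) ≥ ε ν`
(`ε < 1`) as a Markov kernel `κ̂` on `Ω × Bool` and proved the next-step regeneration identity for one
future coordinate.  This file upgrades it to the WHOLE FUTURE PATH, using the uniqueness theorem
`eq_chain_of_tower` of `Scoring/ChainPathLaw.lean` a second time: the measure
`A ↦ E[F(X̂_{≤a}) · 1{coin_{a+1} = heads} · 1_A(X̂_{a+1}, X̂_{a+2}, …)]` satisfies the tower
identities of `κ̂` (they are tower identities of the original chain at later times) and has time-`0`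
marginal `ε E[F] · (ν ⊗ δ_true)`, hence IS `ε E[F] · P̂_{ν ⊗ δ_true, κ̂}`.  Printed counterpart NAMED
ONLY: the regeneration property of the split chain (Nummelin 1978; Athreya–Ney 1978; Meyn–Tweedie
1993 Thm 5.1.3 context / §17.3.1), here at FIXED times; nothing is cited as a fact.

## Content (notation of `Scoring/SplitChain.lean`: split kernel `κ̂` with hypothesis `hκs`, initial
## law `μ̂₀` on `Ω × Bool`, `P̂ = P̂_{μ̂₀,κ̂}`; `F ≥ 0` a bounded measurable functional of the history up
## to time `a`; `θ_{a+1} x̂ := (n ↦ x̂ (a + 1 + n))` the future path from time `a + 1`)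

* `integral_map_shift_withDensity`, `measureReal_map_shift_withDensity` — bookkeeping: integrals
  and masses of the past-weighted, shifted law `(P.withDensity ρ).map θ` are `∫ ρ · (G ∘ θ) dP`;
* **`splitChain_regeneration_pathLaw`** — THE FIXED-TIME REGENERATION THEOREM:
  `(P̂.withDensity (F(X̂_{≤a}) 1{coin_{a+1}})).map θ_{a+1} = (ε · E_P̂[F(X̂_{≤a})]) • P̂_{ν ⊗ δ_true, κ̂}`
  — given any (weighted) past and a head at time `a + 1`, the future path is a fresh split chain
  started from a `ν`-draw;
* **`splitChain_regeneration_integral`** — the same on bounded measurable path functionals `H`: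
  `E[F(X̂_{≤a}) 1{coin_{a+1}} H(θ_{a+1} X̂)] = ε · E[F(X̂_{≤a})] · E_{P̂_{ν ⊗ δ_true}}[H]`
  (past and post-head future FACTORISE);
* **`splitChain_regeneration_statePathLaw`** — composed with `splitChain_map_fst`: the post-head
  STATE path has law `(ε E[F]) • P_{ν,κ}`, the `κ`-chain from `ν` — with `ν = π` invariant, the
  stationary chain.

Reading (value-free): along the chain a seat simulates (which carries a split chain,
`Scoring/SplitChainRegeneration.exists_splitChain`), every update is, with probability `ε`
independently of the past, a regeneration after which the run is a fresh copy of the `κ`-chain from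
`ν`; this is the object from which block decompositions, regenerative variance estimators and
median-of-blocks arguments are built.  NOT CLAIMED: the strong Markov / regeneration property at
the RANDOM head times and the i.i.d. structure of complete excursions (fixed times only here); any
`ε` of a concrete sampler.
-/

noncomputable section

namespace Summit.Ventures.LatticeQCDFlow.Scoring

open MeasureTheory ProbabilityTheory Filter Finset Preorder Literature.Probability.MarkovChains
open scoped ENNReal

variable {Ω : Type*} [MeasurableSpace Ω]

/-! ### Bookkeeping: the past-weighted, shifted law -/

section Weighted

variable {S : Type*} [MeasurableSpace S]

omit [MeasurableSpace Ω] in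
/-- Integrals against `(P.withDensity ρ).map θ_s` for a bounded nonnegative measurable weight `ρ`
and the shift `θ_s x = (n ↦ x (s + n))`: `∫ G d((P.withDensity ρ).map θ_s) = ∫ ρ · (G ∘ θ_s) dP`. -/
theorem integral_map_shift_withDensity (P : Measure (ℕ → S)) (s : ℕ) {ρ : (ℕ → S) → ℝ}
    (hρm : Measurable ρ) (hρ0 : ∀ x, 0 ≤ ρ x) {G : (ℕ → S) → ℝ} (hG : Measurable G) :
    ∫ y, G y ∂((P.withDensity fun x => ENNReal.ofReal (ρ x)).map (fun (x : ℕ → S) (n : ℕ) =>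
        x (s + n)))
      = ∫ x, ρ x * G (fun n => x (s + n)) ∂P := by
  have hθ : Measurable (fun (x : ℕ → S) (n : ℕ) => x (s + n)) :=
    measurable_pi_lambda _ fun n => measurable_pi_apply _
  rw [integral_map hθ.aemeasurable hG.aestronglyMeasurable,
    integral_withDensity_eq_integral_toReal_smul hρm.ennreal_ofReal
      (ae_of_all _ fun x => ENNReal.ofReal_lt_top)]
  refine integral_congr_ae (ae_of_all _ fun x => ?_)
  simp only [ENNReal.toReal_ofReal (hρ0 x), smul_eq_mul]

omit [MeasurableSpace Ω] in
/-- … and masses of measurable sets: `((P.withDensity ρ).map θ_s).real A = ∫ ρ · 1_A(θ_s x) dP`. -/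
theorem measureReal_map_shift_withDensity (P : Measure (ℕ → S)) [IsFiniteMeasure P] (s : ℕ)
    {ρ : (ℕ → S) → ℝ} (hρm : Measurable ρ) (hρ0 : ∀ x, 0 ≤ ρ x) {Cρ : ℝ} (hρC : ∀ x, ρ x ≤ Cρ)
    {A : Set (ℕ → S)} (hA : MeasurableSet A) :
    ((P.withDensity fun x => ENNReal.ofReal (ρ x)).map (fun (x : ℕ → S) (n : ℕ) =>
        x (s + n))).real A
      = ∫ x, ρ x * A.indicator (1 : (ℕ → S) → ℝ) (fun n => x (s + n)) ∂P := by
  have hfin : ∫⁻ x, ENNReal.ofReal (ρ x) ∂P ≠ ⊤ := by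
    refine ne_top_of_le_ne_top ?_ (lintegral_mono fun x => ENNReal.ofReal_le_ofReal (hρC x))
    rw [lintegral_const]
    exact ENNReal.mul_ne_top ENNReal.ofReal_ne_top (measure_ne_top _ _)
  haveI := isFiniteMeasure_withDensity hfin
  rw [← integral_indicator_one hA]
  exact integral_map_shift_withDensity P s hρm hρ0 (measurable_one.indicator hA)

end Weighted

/-! ### The fixed-time regeneration theorem -/

section Regeneration

variable {κ : Kernel Ω Ω} [IsMarkovKernel κ] {ν : Measure Ω} [IsProbabilityMeasure ν] {ε : ℝ≥0∞}
  {hmin : ∀ x {B : Set Ω}, MeasurableSet B → ε * ν B ≤ κ x B}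
  (κs : Kernel (Ω × Bool) (Ω × Bool)) [IsMarkovKernel κs]
  (μs : Measure (Ω × Bool)) [IsProbabilityMeasure μs]

omit [IsMarkovKernel κs] [IsProbabilityMeasure μs] in
/-- The regeneration weight `F(x̂_{≤a}) · 1{coin_{a+1}}` is measurable, nonnegative for `F ≥ 0`, and
bounded by `|CF|`. -/
theorem regenWeight_measurable (a : ℕ) {F : ((i : ↥(Finset.Iic a)) → Ω × Bool) → ℝ}
    (hF : Measurable F) :
    Measurable fun x : ℕ → Ω × Bool =>
      F (frestrictLe a x) * (if (x (a + 1)).2 then (1 : ℝ) else 0) := by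
  refine (hF.comp (measurable_frestrictLe a)).mul ?_
  refine Measurable.ite ?_ measurable_const measurable_const
  exact (measurable_snd.comp (measurable_pi_apply _)) (measurableSet_singleton true)

omit [MeasurableSpace Ω] [IsMarkovKernel κs] [IsProbabilityMeasure μs] in
/-- See `regenWeight_measurable`. -/
theorem regenWeight_nonneg (a : ℕ) {F : ((i : ↥(Finset.Iic a)) → Ω × Bool) → ℝ}
    (hF0 : ∀ h, 0 ≤ F h) (x : ℕ → Ω × Bool) :
    0 ≤ F (frestrictLe a x) * (if (x (a + 1)).2 then (1 : ℝ) else 0) := by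
  refine mul_nonneg (hF0 _) ?_
  split_ifs <;> norm_num

omit [MeasurableSpace Ω] [IsMarkovKernel κs] [IsProbabilityMeasure μs] in
/-- See `regenWeight_measurable`. -/
theorem regenWeight_le (a : ℕ) {F : ((i : ↥(Finset.Iic a)) → Ω × Bool) → ℝ} {CF : ℝ}
    (hCF : ∀ h, |F h| ≤ CF) (x : ℕ → Ω × Bool) :
    F (frestrictLe a x) * (if (x (a + 1)).2 then (1 : ℝ) else 0) ≤ |CF| := by
  have h1 : F (frestrictLe a x) ≤ |CF| := (le_abs_self _).trans ((hCF _).trans (le_abs_self _))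
  split_ifs
  · rw [mul_one]; exact h1
  · rw [mul_zero]; exact abs_nonneg _

/-- **THE FIXED-TIME REGENERATION THEOREM (law of the future path).**  For a split kernel `κ̂` of
`κ(x, ·) ≥ ε ν` (`ε < 1`), any initial law, any time `a` and any bounded measurable `F ≥ 0` of the
history up to `a`:
`(P̂.withDensity (F(X̂_{≤a}) · 1{coin_{a+1} = heads})).map θ_{a+1} = (ε · E[F(X̂_{≤a})]) • P̂_{ν ⊗ δ_true, κ̂}`. -/
theorem splitChain_regeneration_pathLaw (hε : ε < 1)
    (hκs : ∀ p, κs p = (ε • ν).map (fun y : Ω => (y, true))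
      + ((1 - ε) • Doeblin.residualKernel κ ν ε hmin p.1).map (fun y : Ω => (y, false)))
    (a : ℕ) {F : ((i : ↥(Finset.Iic a)) → Ω × Bool) → ℝ} (hF : Measurable F) {CF : ℝ}
    (hCF : ∀ h, |F h| ≤ CF) (hF0 : ∀ h, 0 ≤ F h) :
    ((Kernel.trajMeasure (X := fun _ : ℕ => Ω × Bool) μs
        (fun n : ℕ => κs.comap (fun h : (i : ↥(Finset.Iic n)) → Ω × Bool =>
          h ⟨n, Finset.mem_Iic.2 le_rfl⟩) (measurable_pi_apply _))).withDensity
        (fun x => ENNReal.ofReal (F (frestrictLe a x) * (if (x (a + 1)).2 then (1 : ℝ) else 0)))).map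
        (fun (x : ℕ → Ω × Bool) (n : ℕ) => x (a + 1 + n))
      = ENNReal.ofReal (ε.toReal * ∫ x, F (frestrictLe a x)
          ∂(Kernel.trajMeasure (X := fun _ : ℕ => Ω × Bool) μs
            (fun n : ℕ => κs.comap (fun h : (i : ↥(Finset.Iic n)) → Ω × Bool =>
              h ⟨n, Finset.mem_Iic.2 le_rfl⟩) (measurable_pi_apply _)))) •
        Kernel.trajMeasure (X := fun _ : ℕ => Ω × Bool) (ν.map (fun y : Ω => (y, true)))
          (fun n : ℕ => κs.comap (fun h : (i : ↥(Finset.Iic n)) → Ω × Bool =>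
            h ⟨n, Finset.mem_Iic.2 le_rfl⟩) (measurable_pi_apply _)) := by
  -- notation
  set P := Kernel.trajMeasure (X := fun _ : ℕ => Ω × Bool) μs
      (fun n : ℕ => κs.comap (fun h : (i : ↥(Finset.Iic n)) → Ω × Bool =>
        h ⟨n, Finset.mem_Iic.2 le_rfl⟩) (measurable_pi_apply _)) with hP
  set ρ : (ℕ → Ω × Bool) → ℝ := fun x =>
      F (frestrictLe a x) * (if (x (a + 1)).2 then (1 : ℝ) else 0) with hρ
  set c : ℝ := ε.toReal * ∫ x, F (frestrictLe a x) ∂P with hc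
  haveI hνt : IsProbabilityMeasure (ν.map (fun y : Ω => (y, true))) :=
    Measure.isProbabilityMeasure_map (measurable_tagCoin true).aemeasurable
  have hρm : Measurable ρ := regenWeight_measurable a hF
  have hρ0 : ∀ x, 0 ≤ ρ x := regenWeight_nonneg a hF0
  have hρC : ∀ x, ρ x ≤ |CF| := regenWeight_le a hCF
  have hθ : Measurable (fun (x : ℕ → Ω × Bool) (n : ℕ) => x (a + 1 + n)) :=
    measurable_pi_lambda _ fun n => measurable_pi_apply _
  have hfin : ∫⁻ x, ENNReal.ofReal (ρ x) ∂P ≠ ⊤ := by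
    refine ne_top_of_le_ne_top ?_ (lintegral_mono fun x => ENNReal.ofReal_le_ofReal (hρC x))
    rw [lintegral_const]
    exact ENNReal.mul_ne_top ENNReal.ofReal_ne_top (measure_ne_top _ _)
  haveI : IsFiniteMeasure (P.withDensity fun x => ENNReal.ofReal (ρ x)) :=
    isFiniteMeasure_withDensity hfin
  have hc0 : 0 ≤ c :=
    mul_nonneg ENNReal.toReal_nonneg (integral_nonneg fun x => hF0 _)
  -- total mass: `∫ ρ dP = c` (the coin identity of `Scoring/SplitChain.lean`)
  have hmass : ∫ x, ρ x ∂P = c := by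
    rw [hρ, hc, hP]
    exact splitChain_coin κs μs (κ := κ) (ν := ν) (hmin := hmin) hε hκs a hF hCF
  have hQuniv : ((P.withDensity fun x => ENNReal.ofReal (ρ x)).map
      (fun (x : ℕ → Ω × Bool) (n : ℕ) => x (a + 1 + n))) Set.univ = ENNReal.ofReal c := by
    rw [Measure.map_apply hθ MeasurableSet.univ, Set.preimage_univ,
      withDensity_apply _ MeasurableSet.univ, Measure.restrict_univ,
      ← ofReal_integral_eq_lintegral_ofReal
        (integrable_of_bounded P hρm (C := |CF|) fun x => by
          rw [abs_of_nonneg (hρ0 x)]; exact hρC x)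
        (ae_of_all _ hρ0), hmass]
  by_cases hcz : c = 0
  · -- degenerate: both sides are the zero measure
    have hQ0 : (P.withDensity fun x => ENNReal.ofReal (ρ x)).map
        (fun (x : ℕ → Ω × Bool) (n : ℕ) => x (a + 1 + n)) = 0 := by
      rw [← Measure.measure_univ_eq_zero, hQuniv, hcz, ENNReal.ofReal_zero]
    rw [hQ0, hcz, ENNReal.ofReal_zero, zero_smul]
  have hcpos : 0 < c := lt_of_le_of_ne hc0 (Ne.symm hcz)
  have hc1 : ENNReal.ofReal c ≠ 0 := (ENNReal.ofReal_pos.2 hcpos).ne'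
  have hc2 : ENNReal.ofReal c ≠ ⊤ := ENNReal.ofReal_ne_top
  -- the normalised measure is a probability measure satisfying the tower identities of `κ̂`
  have hQ' : (ENNReal.ofReal c)⁻¹ • (P.withDensity fun x => ENNReal.ofReal (ρ x)).map
      (fun (x : ℕ → Ω × Bool) (n : ℕ) => x (a + 1 + n))
      = Kernel.trajMeasure (X := fun _ : ℕ => Ω × Bool) (ν.map (fun y : Ω => (y, true)))
        (fun n : ℕ => κs.comap (fun h : (i : ↥(Finset.Iic n)) → Ω × Bool =>
          h ⟨n, Finset.mem_Iic.2 le_rfl⟩) (measurable_pi_apply _)) := by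
    haveI : IsProbabilityMeasure ((ENNReal.ofReal c)⁻¹ •
        (P.withDensity fun x => ENNReal.ofReal (ρ x)).map
          (fun (x : ℕ → Ω × Bool) (n : ℕ) => x (a + 1 + n))) :=
      ⟨by rw [Measure.smul_apply, hQuniv, smul_eq_mul, ENNReal.inv_mul_cancel hc1 hc2]⟩
    refine eq_chain_of_tower κs (ν.map (fun y : Ω => (y, true))) _ ?_ ?_
    · -- time-`0` marginal: `ε E[F 1_A(X_{a+1}, true)] / c = ν ⊗ δ_true (A)`
      ext A hA
      have hAt : Measurable fun y : Ω => A.indicator (1 : Ω × Bool → ℝ) (y, true) :=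
        (measurable_one.indicator hA).comp (measurable_tagCoin true)
      have hpre : MeasurableSet ((fun y : ℕ → Ω × Bool => y 0) ⁻¹' A) := measurable_pi_apply 0 hA
      have hreal : ((P.withDensity fun x => ENNReal.ofReal (ρ x)).map
          (fun (x : ℕ → Ω × Bool) (n : ℕ) => x (a + 1 + n))).real
            ((fun y : ℕ → Ω × Bool => y 0) ⁻¹' A)
          = c * (ν.map (fun y : Ω => (y, true))).real A := by
        rw [measureReal_map_shift_withDensity P (a + 1) hρm hρ0 hρC hpre]
        have hpt : ∀ x : ℕ → Ω × Bool,
            ρ x * ((fun y : ℕ → Ω × Bool => y 0) ⁻¹' A).indicator (1 : (ℕ → Ω × Bool) → ℝ)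
              (fun n => x (a + 1 + n))
            = F (frestrictLe a x) * (if (x (a + 1)).2
                then A.indicator (1 : Ω × Bool → ℝ) ((x (a + 1)).1, true) else 0) := by
          intro x
          have hind : ((fun y : ℕ → Ω × Bool => y 0) ⁻¹' A).indicator (1 : (ℕ → Ω × Bool) → ℝ)
              (fun n => x (a + 1 + n)) = A.indicator (1 : Ω × Bool → ℝ) (x (a + 1)) := rfl
          rw [hind, hρ]
          by_cases hx : (x (a + 1)).2 = true
          · have hpair : ((x (a + 1)).1, true) = x (a + 1) := by rw [← hx]
            rw [hpair]; simp [hx]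
          · simp [hx]
        simp_rw [hpt]
        rw [hP, splitChain_regeneration κs μs (κ := κ) (ν := ν) (hmin := hmin) hε hκs a hF hCF hAt
          (Cg := 1) (fun y => by by_cases hy : (y, true) ∈ A <;> simp [hy]), ← hP, hc,
          ← integral_map (measurable_tagCoin true).aemeasurable
            (measurable_one.indicator hA).aestronglyMeasurable, integral_indicator_one hA]
        ring
      rw [Measure.map_apply (measurable_pi_apply 0) hA, Measure.smul_apply, smul_eq_mul,
        ← ofReal_measureReal (measure_ne_top _ _), hreal, ENNReal.ofReal_mul hc0,
        ofReal_measureReal (measure_ne_top _ _), ← mul_assoc, ENNReal.inv_mul_cancel hc1 hc2,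
        one_mul]
    · -- tower identities: they are tower identities of `P` at time `a + 1 + b`
      intro b G hG CG hCG g hg Cg hCg
      rw [integral_smul_measure, integral_smul_measure]
      congr 1
      have hm1 : Measurable fun y : ℕ → Ω × Bool => G (frestrictLe b y) * g (y (b + 1)) :=
        (hG.comp (measurable_frestrictLe b)).mul (hg.comp (measurable_pi_apply _))
      have hm2 : Measurable fun y : ℕ → Ω × Bool => G (frestrictLe b y) * kop κs g (y b) :=
        (hG.comp (measurable_frestrictLe b)).mul ((measurable_kop κs hg).comp (measurable_pi_apply _))
      rw [integral_map_shift_withDensity P (a + 1) hρm hρ0 hm1,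
        integral_map_shift_withDensity P (a + 1) hρm hρ0 hm2]
      -- the combined history functional up to time `a + 1 + b`
      have hF' : Measurable fun h : (i : ↥(Finset.Iic (a + 1 + b))) → Ω × Bool =>
          F (fun i : ↥(Finset.Iic a) => h ⟨i, Finset.mem_Iic.2
              (by have := Finset.mem_Iic.1 i.2; omega)⟩)
            * (if (h ⟨a + 1, Finset.mem_Iic.2 (by omega)⟩).2 then (1 : ℝ) else 0)
            * G (fun j : ↥(Finset.Iic b) => h ⟨a + 1 + j, Finset.mem_Iic.2
              (by have := Finset.mem_Iic.1 j.2; omega)⟩) := by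
        refine (((hF.comp (measurable_pi_lambda _ fun i => measurable_pi_apply _)).mul ?_).mul
          (hG.comp (measurable_pi_lambda _ fun j => measurable_pi_apply _)))
        refine Measurable.ite ?_ measurable_const measurable_const
        exact (measurable_snd.comp (measurable_pi_apply _)) (measurableSet_singleton true)
      have hCF' : ∀ h : (i : ↥(Finset.Iic (a + 1 + b))) → Ω × Bool,
          |F (fun i : ↥(Finset.Iic a) => h ⟨i, Finset.mem_Iic.2
              (by have := Finset.mem_Iic.1 i.2; omega)⟩)
            * (if (h ⟨a + 1, Finset.mem_Iic.2 (by omega)⟩).2 then (1 : ℝ) else 0)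
            * G (fun j : ↥(Finset.Iic b) => h ⟨a + 1 + j, Finset.mem_Iic.2
              (by have := Finset.mem_Iic.1 j.2; omega)⟩)| ≤ |CF| * 1 * CG := fun h => by
        rw [abs_mul, abs_mul]
        refine mul_le_mul (mul_le_mul ((hCF _).trans (le_abs_self _)) ?_ (abs_nonneg _)
          (abs_nonneg _)) (hCG _) (abs_nonneg _) (mul_nonneg (abs_nonneg _) zero_le_one)
        split_ifs <;> simp
      have key := chain_tower κs μs (a + 1 + b) hF' hCF' hg hCg
      rw [← hP] at key
      have e1 : ∫ x, ρ x * (G (frestrictLe b fun n => x (a + 1 + n)) * g (x (a + 1 + (b + 1)))) ∂P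
          = ∫ x, F (fun i : ↥(Finset.Iic a) => frestrictLe (a + 1 + b) x ⟨i, Finset.mem_Iic.2
              (by have := Finset.mem_Iic.1 i.2; omega)⟩)
            * (if (frestrictLe (a + 1 + b) x ⟨a + 1, Finset.mem_Iic.2 (by omega)⟩).2
                then (1 : ℝ) else 0)
            * G (fun j : ↥(Finset.Iic b) => frestrictLe (a + 1 + b) x ⟨a + 1 + j, Finset.mem_Iic.2
              (by have := Finset.mem_Iic.1 j.2; omega)⟩)
            * g (x (a + 1 + b + 1)) ∂P := by
        refine integral_congr_ae (ae_of_all _ fun x => ?_)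
        show ρ x * (G (frestrictLe b fun n => x (a + 1 + n)) * g (x (a + 1 + (b + 1))))
          = F (frestrictLe a x) * (if (x (a + 1)).2 then (1 : ℝ) else 0)
            * G (frestrictLe b fun n => x (a + 1 + n)) * g (x (a + 1 + b + 1))
        rw [hρ, show a + 1 + (b + 1) = a + 1 + b + 1 from rfl]
        ring
      have e2 : ∫ x, ρ x * (G (frestrictLe b fun n => x (a + 1 + n))
            * kop κs g ((fun n => x (a + 1 + n)) b)) ∂P
          = ∫ x, F (fun i : ↥(Finset.Iic a) => frestrictLe (a + 1 + b) x ⟨i, Finset.mem_Iic.2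
              (by have := Finset.mem_Iic.1 i.2; omega)⟩)
            * (if (frestrictLe (a + 1 + b) x ⟨a + 1, Finset.mem_Iic.2 (by omega)⟩).2
                then (1 : ℝ) else 0)
            * G (fun j : ↥(Finset.Iic b) => frestrictLe (a + 1 + b) x ⟨a + 1 + j, Finset.mem_Iic.2
              (by have := Finset.mem_Iic.1 j.2; omega)⟩)
            * kop κs g (x (a + 1 + b)) ∂P := by
        refine integral_congr_ae (ae_of_all _ fun x => ?_)
        show ρ x * (G (frestrictLe b fun n => x (a + 1 + n)) * kop κs g (x (a + 1 + b)))
          = F (frestrictLe a x) * (if (x (a + 1)).2 then (1 : ℝ) else 0)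
            * G (frestrictLe b fun n => x (a + 1 + n)) * kop κs g (x (a + 1 + b))
        rw [hρ]
        ring
      rw [e1, e2]
      exact key
  -- un-normalise
  calc (P.withDensity fun x => ENNReal.ofReal (ρ x)).map
        (fun (x : ℕ → Ω × Bool) (n : ℕ) => x (a + 1 + n))
      = ENNReal.ofReal c • ((ENNReal.ofReal c)⁻¹ •
          (P.withDensity fun x => ENNReal.ofReal (ρ x)).map
            (fun (x : ℕ → Ω × Bool) (n : ℕ) => x (a + 1 + n))) := by
        rw [smul_smul, ENNReal.mul_inv_cancel hc1 hc2, one_smul]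
    _ = _ := by rw [hQ']

/-- **REGENERATION ON PATH FUNCTIONALS (past and post-head future factorise).**  Same hypotheses;
for every bounded measurable functional `H` of a path:
`E[F(X̂_{≤a}) · 1{coin_{a+1}} · H(θ_{a+1} X̂)] = ε · E[F(X̂_{≤a})] · E_{P̂_{ν ⊗ δ_true, κ̂}}[H]`. -/
theorem splitChain_regeneration_integral (hε : ε < 1)
    (hκs : ∀ p, κs p = (ε • ν).map (fun y : Ω => (y, true))
      + ((1 - ε) • Doeblin.residualKernel κ ν ε hmin p.1).map (fun y : Ω => (y, false)))
    (a : ℕ) {F : ((i : ↥(Finset.Iic a)) → Ω × Bool) → ℝ} (hF : Measurable F) {CF : ℝ}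
    (hCF : ∀ h, |F h| ≤ CF) (hF0 : ∀ h, 0 ≤ F h) {H : (ℕ → Ω × Bool) → ℝ} (hH : Measurable H) :
    ∫ x, F (frestrictLe a x) * (if (x (a + 1)).2 then (1 : ℝ) else 0) * H (fun n => x (a + 1 + n))
        ∂(Kernel.trajMeasure (X := fun _ : ℕ => Ω × Bool) μs
          (fun n : ℕ => κs.comap (fun h : (i : ↥(Finset.Iic n)) → Ω × Bool =>
            h ⟨n, Finset.mem_Iic.2 le_rfl⟩) (measurable_pi_apply _)))
      = ε.toReal * (∫ x, F (frestrictLe a x)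
          ∂(Kernel.trajMeasure (X := fun _ : ℕ => Ω × Bool) μs
            (fun n : ℕ => κs.comap (fun h : (i : ↥(Finset.Iic n)) → Ω × Bool =>
              h ⟨n, Finset.mem_Iic.2 le_rfl⟩) (measurable_pi_apply _))))
        * ∫ y, H y ∂(Kernel.trajMeasure (X := fun _ : ℕ => Ω × Bool) (ν.map (fun y : Ω => (y, true)))
          (fun n : ℕ => κs.comap (fun h : (i : ↥(Finset.Iic n)) → Ω × Bool =>
            h ⟨n, Finset.mem_Iic.2 le_rfl⟩) (measurable_pi_apply _))) := by
  have h := integral_map_shift_withDensity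
    (Kernel.trajMeasure (X := fun _ : ℕ => Ω × Bool) μs
      (fun n : ℕ => κs.comap (fun h : (i : ↥(Finset.Iic n)) → Ω × Bool =>
        h ⟨n, Finset.mem_Iic.2 le_rfl⟩) (measurable_pi_apply _))) (a + 1)
    (regenWeight_measurable a hF) (regenWeight_nonneg a hF0) hH
  rw [splitChain_regeneration_pathLaw κs μs (κ := κ) (ν := ν) (hmin := hmin) hε hκs a hF hCF hF0,
    integral_smul_measure, ENNReal.toReal_ofReal
      (mul_nonneg ENNReal.toReal_nonneg (integral_nonneg fun x => hF0 _)), smul_eq_mul] at h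
  rw [← h]

/-- **THE POST-HEAD STATE PATH IS THE `κ`-CHAIN FROM `ν`.**  Same hypotheses:
`(P̂.withDensity (F(X̂_{≤a}) 1{coin_{a+1}})).map (x̂ ↦ (n ↦ (x̂ (a + 1 + n)).1)) = (ε E[F]) • P_{ν,κ}`
— given any weighted past and a head at `a + 1`, the future STATES form the `κ`-chain started
afresh from `ν` (for `ν = π` invariant: the stationary chain). -/
theorem splitChain_regeneration_statePathLaw (hε : ε < 1)
    (hκs : ∀ p, κs p = (ε • ν).map (fun y : Ω => (y, true))
      + ((1 - ε) • Doeblin.residualKernel κ ν ε hmin p.1).map (fun y : Ω => (y, false)))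
    (a : ℕ) {F : ((i : ↥(Finset.Iic a)) → Ω × Bool) → ℝ} (hF : Measurable F) {CF : ℝ}
    (hCF : ∀ h, |F h| ≤ CF) (hF0 : ∀ h, 0 ≤ F h) :
    ((Kernel.trajMeasure (X := fun _ : ℕ => Ω × Bool) μs
        (fun n : ℕ => κs.comap (fun h : (i : ↥(Finset.Iic n)) → Ω × Bool =>
          h ⟨n, Finset.mem_Iic.2 le_rfl⟩) (measurable_pi_apply _))).withDensity
        (fun x => ENNReal.ofReal (F (frestrictLe a x) * (if (x (a + 1)).2 then (1 : ℝ) else 0)))).map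
        (fun (x : ℕ → Ω × Bool) (n : ℕ) => (x (a + 1 + n)).1)
      = ENNReal.ofReal (ε.toReal * ∫ x, F (frestrictLe a x)
          ∂(Kernel.trajMeasure (X := fun _ : ℕ => Ω × Bool) μs
            (fun n : ℕ => κs.comap (fun h : (i : ↥(Finset.Iic n)) → Ω × Bool =>
              h ⟨n, Finset.mem_Iic.2 le_rfl⟩) (measurable_pi_apply _)))) •
        Kernel.trajMeasure (X := fun _ : ℕ => Ω) ν
          (fun n : ℕ => κ.comap (fun h : (i : ↥(Finset.Iic n)) → Ω => h ⟨n, Finset.mem_Iic.2 le_rfl⟩)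
            (measurable_pi_apply _)) := by
  haveI hνt : IsProbabilityMeasure (ν.map (fun y : Ω => (y, true))) :=
    Measure.isProbabilityMeasure_map (measurable_tagCoin true).aemeasurable
  have hθ : Measurable (fun (x : ℕ → Ω × Bool) (n : ℕ) => x (a + 1 + n)) :=
    measurable_pi_lambda _ fun n => measurable_pi_apply _
  have hfst : Measurable (fun (x : ℕ → Ω × Bool) (n : ℕ) => (x n).1) :=
    measurable_pi_lambda _ fun n => measurable_fst.comp (measurable_pi_apply _)
  have hcomp : (fun (x : ℕ → Ω × Bool) (n : ℕ) => (x (a + 1 + n)).1)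
      = (fun (x : ℕ → Ω × Bool) (n : ℕ) => (x n).1) ∘ (fun (x : ℕ → Ω × Bool) (n : ℕ) =>
          x (a + 1 + n)) := rfl
  rw [hcomp, ← Measure.map_map hfst hθ,
    splitChain_regeneration_pathLaw κs μs (κ := κ) (ν := ν) (hmin := hmin) hε hκs a hF hCF hF0,
    Measure.map_smul, splitChain_map_fst κs _ (κ := κ) (ν := ν) (hmin := hmin) hε hκs,
    Measure.map_map measurable_fst (measurable_tagCoin true)]
  have : Prod.fst ∘ (fun y : Ω => (y, true)) = id := rfl
  rw [this, Measure.map_id]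

end Regeneration

end Summit.Ventures.LatticeQCDFlow.Scoring

end
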